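import Mathlib
import HarnessLib
import Summits.HubbardSuperconductivity.HubbardSuperconductivity.Theorems.KLProgrammeH10TwoPointLimitPerturbedCountKappa

/-!
# Route `KLProgramme` — definitions: the CLOSED-FORM small constants of the THIN anchored sector count on the perturbed Fermi curve
# (`κ_thin, τ, λ, η₀F, e, s` of `exists_thin_small_constants`), with their positivity and the unpacking of the minima

Cell gate-hubbard-kl, seat p3 g25; located #15 «(X).1-C-DOOR-SLOT» (pen (R535)(A), cure (γ) IN TEXT, step 1).  The anchored thin 4-sector count of
the engine's (X).1/(b) rows (`card_bgmSectorSet_klAniso_anchored_le_doors`, door `c ≤ klThinCountC₃ R`) descends from `countPairs_thin_perturbed`, whose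
perturbation size `κ` is produced by `exists_thin_small_constants` (`…PerturbedCountThinSmallness`) through a five-stage CONTINUITY cascade at `0` — an
opaque witness, so the regime door `klThinCountC₃ R := Classical.choose …` cannot be compared with the engine's explicit `klEngC₃6`.  Following p4 g4's
explicitation of the NON-thin count (`KLProgrammePerturbedCountConstantsDefs` §«free small constants»: `pcTau, pcLam, pcEta0, pcEta1, pcKappaStar`;
`…PerturbedCountKappa`: the uniform majorants `pcSEbar, pcAEbar` and the affine-in-`κ` losses `pcE4/pcOdd/pcEven/pcDiag_le_affine`), this file NAMES
a closed-form cascade for the THIN count, chosen against the BAR majorants so that every one of the thirty smallness conditions is linear arithmetic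
(proved in `…PerturbedCountThinSmallnessExplicit{Bounds,}`):

* `pcAdiagBar = 20S̄² + 10Ā`, `pcMGBar = 10S̄² + 5Ā` (majorants of `pcAdiag`, `pcMG` on `κ ≤ min(1, Dt/2)`); slopes `pcThinDA`, `pcThinDE`, `pcThinDK`, `pcThinDW`, `pcThinDT`;
* the cascade `pcThinS B m` (stratum, `≤ m`, `≤ 1/2`) ≫ `pcThinZm` (near-critical bracket ceiling) ≫ `pcThinE` (near-critical threshold) ≫ `pcThinTau` (row window)
  ≫ `pcThinLam` (partial threshold), `pcThinF` (fat level) ≫ **`pcThinKappa B m`** (the explicit perturbation size) — each a `min` of closed-form quotients of the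
  `BandBounds` fields `s_max, h_min, C_g, Dt_min, u_min, ρ_min`, `umklappRadius b` and `m`;
* `pcThin_slopes_pos`, `pcThinS_pos … pcThinKappa_pos` (all positive for `m > 0`), `pcThinS_le … pcThinKappa_le` (the `min`-components, by name).
Definitions of real constants + elementary facts; nothing about the Hubbard model is asserted.
References: BGM 2006 Lemma 3.1 / App. A2–A3 [cite: BenfattoGiulianiMastropietro2006]; Mastropietro 2008 (14.67) [cite: Mastropietro2008].
-/

noncomputable section

namespace Summit.HubbardSuperconductivity.HubbardSuperconductivity.Theorems.PerturbedFermiCurve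

set_option linter.dupNamespace false -- summit = problem name (single-conjunct summit), D-0017

open Real Set
open Literature.MathematicalPhysics.QuantumLattice Literature.MathematicalPhysics.QuantumLattice.BandSectorCounting

variable {a b : ℝ}

/-! ## §1 The closed-form cascade -/

/-- `Ā_diag = 20S̄_E² + 10Ā_E ≥ A_diag(κ,κ)` for `κ ≤ min(1, Dt_min/2)`. -/
def pcAdiagBar (B : BandBounds a b) : ℝ := 20 * pcSEbar B ^ 2 + 10 * pcAEbar B

/-- `M̄_Γ = 10S̄_E² + 5Ā_E ≥ M_Γ(κ,κ)` for `κ ≤ min(1, Dt_min/2)`. -/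
def pcMGBar (B : BandBounds a b) : ℝ := 10 * pcSEbar B ^ 2 + 5 * pcAEbar B

/-- Slope of the diagonal-stratum loss in the stratum level: `(16S̄² + 8Ā)(1/Dt + s C_g (1/4 + 2s/Dt))`. -/
def pcThinDA (B : BandBounds a b) : ℝ :=
  (16 * pcSEbar B ^ 2 + 8 * pcAEbar B) * (1 / B.Dtmin + B.smax * (B.Cg * (1 / 4 + 2 * B.smax * (1 / B.Dtmin))))

/-- Slope in `e` of the near-critical bracket `Z`: `1/Dt + s C_g (1/4 + 2s/Dt)`. -/
def pcThinDE (B : BandBounds a b) : ℝ := 1 / B.Dtmin + B.smax * (B.Cg * (1 / 4 + 2 * B.smax * (1 / B.Dtmin)))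

/-- Slope in `κ` of the near-critical brackets: `2/Dt + s C_g · pcE4slope`. -/
def pcThinDK (B : BandBounds a b) : ℝ := 2 / B.Dtmin + B.smax * (B.Cg * pcE4slope B)

/-- Slope in `e` of the forward-window bracket `W`: `2/Dt + s C_g/2 + 4 s² C_g/Dt`. -/
def pcThinDW (B : BandBounds a b) : ℝ := 2 / B.Dtmin + B.smax * B.Cg / 2 + 4 * B.smax ^ 2 * B.Cg / B.Dtmin

/-- Slope in `τ` of the forward-window bracket `W`: `s C_g (5/4)Ā + s/2`. -/
def pcThinDT (B : BandBounds a b) : ℝ := B.smax * (B.Cg * (5 / 4 * pcAEbar B)) + B.smax / 2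

/-- **The stratum level** `s(m) = min(m, 1/2, h/pcThinDA)`. -/
def pcThinS (B : BandBounds a b) (m : ℝ) : ℝ := min m (min (1 / 2) (B.hmin / pcThinDA B))

/-- **The near-critical bracket ceiling** `Z_m = min(ρ²/4, 1/4, 1 − K/π, s√2u/(Ā_diag π²), √2u/π²)`. -/
def pcThinZm (B : BandBounds a b) (m : ℝ) : ℝ :=
  min (B.rhomin ^ 2 / 4) (min (1 / 4) (min (1 - umklappRadius b / π)
    (min (pcThinS B m * (Real.sqrt 2 * B.umin) / (pcAdiagBar B * π ^ 2)) (Real.sqrt 2 * B.umin / π ^ 2))))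

/-- **The near-critical threshold** `e(m)`. -/
def pcThinE (B : BandBounds a b) (m : ℝ) : ℝ :=
  min (pcThinS B m / 4) (min (pcThinS B m * B.hmin / (B.hmin + 20 * pcSEbar B)) (min (pcThinS B m * B.hmin / (B.hmin + 2 * pcAdiagBar B))
    (min (pcThinZm B m / (2 * pcThinDE B)) (min (B.hmin * B.Dtmin / (48 * pcAEbar B)) (min (B.hmin / (12 * pcAEbar B * B.smax * B.Cg))
      (min (B.hmin * B.Dtmin / (96 * pcAEbar B * B.smax ^ 2 * B.Cg)) (B.rhomin ^ 2 / (8 * pcThinDW B))))))))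

/-- **The row window** `τ(m)`. -/
def pcThinTau (B : BandBounds a b) (m : ℝ) : ℝ :=
  min (1 / 2) (min (B.hmin / (20 * pcAEbar B * B.smax)) (min (B.hmin / (30 * pcAEbar B ^ 2 * B.smax * B.Cg))
    (min (pcThinE B m / (2 * pcMGBar B)) (min (2 * pcThinE B m / (5 * pcAEbar B)) (min (B.rhomin ^ 2 / (12 * pcSEbar B))
      (B.rhomin ^ 2 / (8 * pcThinDT B)))))))

/-- **The partial threshold** `λ(m)`. -/
def pcThinLam (B : BandBounds a b) (m : ℝ) : ℝ :=
  min (pcThinE B m / 4) (min (pcThinTau B m / (4 * B.Cg)) (B.hmin / (24 * pcAEbar B * B.smax * B.Cg)))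

/-- **The fat level** `η₀F(m)`. -/
def pcThinF (B : BandBounds a b) (m : ℝ) : ℝ :=
  min (pcThinS B m) (min (pcThinTau B m * B.Dtmin / (16 * B.Cg * B.smax)) (min (B.hmin * B.Dtmin / (24 * pcAEbar B))
    (B.hmin * B.Dtmin / (48 * pcAEbar B * B.smax ^ 2 * B.Cg))))

/-- **The explicit perturbation size of the THIN anchored count** `κ_thin(m)`. -/
def pcThinKappa (B : BandBounds a b) (m : ℝ) : ℝ :=
  min 1 (min (B.Dtmin / 4) (min (pcThinS B m) (min (pcThinTau B m / (8 * B.Cg * pcE4slope B)) (min (B.hmin / (10 * pcOddSlope B))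
    (min (B.hmin / (2 * pcAEbar B)) (min (B.hmin / (12 * pcEvenSlope B)) (min (B.hmin / pcDiagSlope B)
      (min (pcThinZm B m / (2 * pcThinDK B)) (B.rhomin ^ 2 / (8 * pcThinDK B))))))))))

/-! ## §2 Positivity (`m > 0`) -/

section Pos

variable (B : BandBounds a b) {m : ℝ} (hm : 0 < m)
include hm

omit hm in
/-- The slopes and bar majorants are positive. -/
theorem pcThin_slopes_pos : 0 < pcAdiagBar B ∧ 0 < pcMGBar B ∧ 0 < pcThinDA B ∧ 0 < pcThinDE B ∧ 0 < pcThinDK B ∧ 0 < pcThinDW B ∧ 0 < pcThinDT B := by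
  have hs := B.smax_pos; have hDt := B.Dtmin_pos; have hCg := B.Cg_pos
  obtain ⟨-, hSEb, -, -, hAEb, he4s, -⟩ := pcbar_pos B
  refine ⟨by unfold pcAdiagBar; positivity, by unfold pcMGBar; positivity, by unfold pcThinDA; positivity, by unfold pcThinDE; positivity,
    by unfold pcThinDK; positivity, by unfold pcThinDW; positivity, by unfold pcThinDT; positivity⟩

/-- `0 < s(m)`. -/
theorem pcThinS_pos : 0 < pcThinS B m := by
  have hh := B.hmin_pos
  obtain ⟨-, -, hDA, -⟩ := pcThin_slopes_pos B
  unfold pcThinS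
  exact lt_min hm (lt_min (by norm_num) (by positivity))

/-- `0 < Z_m`. -/
theorem pcThinZm_pos : 0 < pcThinZm B m := by
  have hρ := B.rhomin_pos; have hu := B.umin_pos; have hπ := Real.pi_pos
  have hS := pcThinS_pos B hm
  obtain ⟨hAd, -⟩ := pcThin_slopes_pos B
  have hK : umklappRadius b < π := umklappRadius_lt_pi B.hb
  have hK1 : 0 < 1 - umklappRadius b / π := by
    rw [sub_pos, div_lt_one hπ]; exact hK
  have hs2 : 0 < Real.sqrt 2 := Real.sqrt_pos.2 (by norm_num)
  unfold pcThinZm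
  exact lt_min (by positivity) (lt_min (by norm_num) (lt_min hK1 (lt_min (by positivity) (by positivity))))

/-- `0 < e(m)`. -/
theorem pcThinE_pos : 0 < pcThinE B m := by
  have hh := B.hmin_pos; have hDt := B.Dtmin_pos; have hs := B.smax_pos; have hCg := B.Cg_pos; have hρ := B.rhomin_pos
  have hS := pcThinS_pos B hm; have hZ := pcThinZm_pos B hm
  obtain ⟨hAd, -, -, hDE, -, hDW, -⟩ := pcThin_slopes_pos B
  obtain ⟨-, hSEb, -, -, hAEb, -⟩ := pcbar_pos B
  unfold pcThinE
  exact lt_min (by positivity) (lt_min (by positivity) (lt_min (by positivity) (lt_min (by positivity) (lt_min (by positivity)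
    (lt_min (by positivity) (lt_min (by positivity) (by positivity)))))))

/-- `0 < τ(m)`. -/
theorem pcThinTau_pos : 0 < pcThinTau B m := by
  have hh := B.hmin_pos; have hs := B.smax_pos; have hCg := B.Cg_pos; have hρ := B.rhomin_pos
  have hE := pcThinE_pos B hm
  obtain ⟨-, hMG, -, -, -, -, hDT⟩ := pcThin_slopes_pos B
  obtain ⟨-, hSEb, -, -, hAEb, -⟩ := pcbar_pos B
  unfold pcThinTau
  exact lt_min (by norm_num) (lt_min (by positivity) (lt_min (by positivity) (lt_min (by positivity) (lt_min (by positivity)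
    (lt_min (by positivity) (by positivity))))))

/-- `0 < λ(m)`. -/
theorem pcThinLam_pos : 0 < pcThinLam B m := by
  have hh := B.hmin_pos; have hs := B.smax_pos; have hCg := B.Cg_pos
  have hE := pcThinE_pos B hm; have hT := pcThinTau_pos B hm
  obtain ⟨-, -, -, -, hAEb, -⟩ := pcbar_pos B
  unfold pcThinLam
  exact lt_min (by positivity) (lt_min (by positivity) (by positivity))

/-- `0 < η₀F(m)`. -/
theorem pcThinF_pos : 0 < pcThinF B m := by
  have hh := B.hmin_pos; have hs := B.smax_pos; have hCg := B.Cg_pos; have hDt := B.Dtmin_pos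
  have hS := pcThinS_pos B hm; have hT := pcThinTau_pos B hm
  obtain ⟨-, -, -, -, hAEb, -⟩ := pcbar_pos B
  unfold pcThinF
  exact lt_min hS (lt_min (by positivity) (lt_min (by positivity) (by positivity)))

/-- **`0 < κ_thin(m)`.** -/
theorem pcThinKappa_pos : 0 < pcThinKappa B m := by
  have hh := B.hmin_pos; have hs := B.smax_pos; have hCg := B.Cg_pos; have hDt := B.Dtmin_pos; have hρ := B.rhomin_pos
  have hS := pcThinS_pos B hm; have hT := pcThinTau_pos B hm; have hZ := pcThinZm_pos B hm
  obtain ⟨-, -, -, -, hAEb, he4s, hodd, heven, hdiag⟩ := pcbar_pos B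
  obtain ⟨-, -, -, -, hDK, -⟩ := pcThin_slopes_pos B
  unfold pcThinKappa
  exact lt_min one_pos (lt_min (by positivity) (lt_min hS (lt_min (by positivity) (lt_min (by positivity) (lt_min (by positivity)
    (lt_min (by positivity) (lt_min (by positivity) (lt_min (by positivity) (by positivity)))))))))

end Pos

/-! ## §3 Unpacking the minima -/

section Unpack

variable (B : BandBounds a b) (m : ℝ)

/-- The components of `s(m)`. -/
theorem pcThinS_le : pcThinS B m ≤ m ∧ pcThinS B m ≤ 1 / 2 ∧ pcThinS B m ≤ B.hmin / pcThinDA B :=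
  ⟨min_le_left _ _, (min_le_right _ _).trans (min_le_left _ _), (min_le_right _ _).trans (min_le_right _ _)⟩

/-- The components of `Z_m`. -/
theorem pcThinZm_le : pcThinZm B m ≤ B.rhomin ^ 2 / 4 ∧ pcThinZm B m ≤ 1 / 4 ∧ pcThinZm B m ≤ 1 - umklappRadius b / π ∧
    pcThinZm B m ≤ pcThinS B m * (Real.sqrt 2 * B.umin) / (pcAdiagBar B * π ^ 2) ∧ pcThinZm B m ≤ Real.sqrt 2 * B.umin / π ^ 2 := by
  unfold pcThinZm
  refine ⟨min_le_left _ _, (min_le_right _ _).trans (min_le_left _ _), (min_le_right _ _).trans ((min_le_right _ _).trans (min_le_left _ _)),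
    (min_le_right _ _).trans ((min_le_right _ _).trans ((min_le_right _ _).trans (min_le_left _ _))),
    (min_le_right _ _).trans ((min_le_right _ _).trans ((min_le_right _ _).trans (min_le_right _ _)))⟩

/-- The components of `e(m)`. -/
theorem pcThinE_le : pcThinE B m ≤ pcThinS B m / 4 ∧ pcThinE B m ≤ pcThinS B m * B.hmin / (B.hmin + 20 * pcSEbar B) ∧
    pcThinE B m ≤ pcThinS B m * B.hmin / (B.hmin + 2 * pcAdiagBar B) ∧ pcThinE B m ≤ pcThinZm B m / (2 * pcThinDE B) ∧
    pcThinE B m ≤ B.hmin * B.Dtmin / (48 * pcAEbar B) ∧ pcThinE B m ≤ B.hmin / (12 * pcAEbar B * B.smax * B.Cg) ∧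
    pcThinE B m ≤ B.hmin * B.Dtmin / (96 * pcAEbar B * B.smax ^ 2 * B.Cg) ∧ pcThinE B m ≤ B.rhomin ^ 2 / (8 * pcThinDW B) := by
  unfold pcThinE
  refine ⟨min_le_left _ _, ?_, ?_, ?_, ?_, ?_, ?_, ?_⟩
  · exact (min_le_right _ _).trans (min_le_left _ _)
  · exact (min_le_right _ _).trans ((min_le_right _ _).trans (min_le_left _ _))
  · exact (min_le_right _ _).trans ((min_le_right _ _).trans ((min_le_right _ _).trans (min_le_left _ _)))
  · exact (min_le_right _ _).trans ((min_le_right _ _).trans ((min_le_right _ _).trans ((min_le_right _ _).trans (min_le_left _ _))))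
  · exact (min_le_right _ _).trans ((min_le_right _ _).trans ((min_le_right _ _).trans ((min_le_right _ _).trans ((min_le_right _ _).trans
      (min_le_left _ _)))))
  · exact (min_le_right _ _).trans ((min_le_right _ _).trans ((min_le_right _ _).trans ((min_le_right _ _).trans ((min_le_right _ _).trans
      ((min_le_right _ _).trans (min_le_left _ _))))))
  · exact (min_le_right _ _).trans ((min_le_right _ _).trans ((min_le_right _ _).trans ((min_le_right _ _).trans ((min_le_right _ _).trans
      ((min_le_right _ _).trans (min_le_right _ _))))))

/-- The components of `τ(m)`. -/
theorem pcThinTau_le : pcThinTau B m ≤ 1 / 2 ∧ pcThinTau B m ≤ B.hmin / (20 * pcAEbar B * B.smax) ∧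
    pcThinTau B m ≤ B.hmin / (30 * pcAEbar B ^ 2 * B.smax * B.Cg) ∧ pcThinTau B m ≤ pcThinE B m / (2 * pcMGBar B) ∧
    pcThinTau B m ≤ 2 * pcThinE B m / (5 * pcAEbar B) ∧ pcThinTau B m ≤ B.rhomin ^ 2 / (12 * pcSEbar B) ∧
    pcThinTau B m ≤ B.rhomin ^ 2 / (8 * pcThinDT B) := by
  unfold pcThinTau
  refine ⟨min_le_left _ _, ?_, ?_, ?_, ?_, ?_, ?_⟩
  · exact (min_le_right _ _).trans (min_le_left _ _)
  · exact (min_le_right _ _).trans ((min_le_right _ _).trans (min_le_left _ _))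
  · exact (min_le_right _ _).trans ((min_le_right _ _).trans ((min_le_right _ _).trans (min_le_left _ _)))
  · exact (min_le_right _ _).trans ((min_le_right _ _).trans ((min_le_right _ _).trans ((min_le_right _ _).trans (min_le_left _ _))))
  · exact (min_le_right _ _).trans ((min_le_right _ _).trans ((min_le_right _ _).trans ((min_le_right _ _).trans ((min_le_right _ _).trans
      (min_le_left _ _)))))
  · exact (min_le_right _ _).trans ((min_le_right _ _).trans ((min_le_right _ _).trans ((min_le_right _ _).trans ((min_le_right _ _).trans
      (min_le_right _ _)))))

/-- The components of `λ(m)`. -/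
theorem pcThinLam_le : pcThinLam B m ≤ pcThinE B m / 4 ∧ pcThinLam B m ≤ pcThinTau B m / (4 * B.Cg) ∧
    pcThinLam B m ≤ B.hmin / (24 * pcAEbar B * B.smax * B.Cg) := by
  unfold pcThinLam
  exact ⟨min_le_left _ _, (min_le_right _ _).trans (min_le_left _ _), (min_le_right _ _).trans (min_le_right _ _)⟩

/-- The components of `η₀F(m)`. -/
theorem pcThinF_le : pcThinF B m ≤ pcThinS B m ∧ pcThinF B m ≤ pcThinTau B m * B.Dtmin / (16 * B.Cg * B.smax) ∧
    pcThinF B m ≤ B.hmin * B.Dtmin / (24 * pcAEbar B) ∧ pcThinF B m ≤ B.hmin * B.Dtmin / (48 * pcAEbar B * B.smax ^ 2 * B.Cg) := by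
  unfold pcThinF
  exact ⟨min_le_left _ _, (min_le_right _ _).trans (min_le_left _ _), (min_le_right _ _).trans ((min_le_right _ _).trans (min_le_left _ _)),
    (min_le_right _ _).trans ((min_le_right _ _).trans (min_le_right _ _))⟩

/-- The components of `κ_thin(m)`. -/
theorem pcThinKappa_le : pcThinKappa B m ≤ 1 ∧ pcThinKappa B m ≤ B.Dtmin / 4 ∧ pcThinKappa B m ≤ pcThinS B m ∧
    pcThinKappa B m ≤ pcThinTau B m / (8 * B.Cg * pcE4slope B) ∧ pcThinKappa B m ≤ B.hmin / (10 * pcOddSlope B) ∧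
    pcThinKappa B m ≤ B.hmin / (2 * pcAEbar B) ∧ pcThinKappa B m ≤ B.hmin / (12 * pcEvenSlope B) ∧ pcThinKappa B m ≤ B.hmin / pcDiagSlope B ∧
    pcThinKappa B m ≤ pcThinZm B m / (2 * pcThinDK B) ∧ pcThinKappa B m ≤ B.rhomin ^ 2 / (8 * pcThinDK B) := by
  unfold pcThinKappa
  refine ⟨min_le_left _ _, ?_, ?_, ?_, ?_, ?_, ?_, ?_, ?_, ?_⟩
  · exact (min_le_right _ _).trans (min_le_left _ _)
  · exact (min_le_right _ _).trans ((min_le_right _ _).trans (min_le_left _ _))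
  · exact (min_le_right _ _).trans ((min_le_right _ _).trans ((min_le_right _ _).trans (min_le_left _ _)))
  · exact (min_le_right _ _).trans ((min_le_right _ _).trans ((min_le_right _ _).trans ((min_le_right _ _).trans (min_le_left _ _))))
  · exact (min_le_right _ _).trans ((min_le_right _ _).trans ((min_le_right _ _).trans ((min_le_right _ _).trans ((min_le_right _ _).trans
      (min_le_left _ _)))))
  · exact (min_le_right _ _).trans ((min_le_right _ _).trans ((min_le_right _ _).trans ((min_le_right _ _).trans ((min_le_right _ _).trans
      ((min_le_right _ _).trans (min_le_left _ _))))))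
  · exact (min_le_right _ _).trans ((min_le_right _ _).trans ((min_le_right _ _).trans ((min_le_right _ _).trans ((min_le_right _ _).trans
      ((min_le_right _ _).trans ((min_le_right _ _).trans (min_le_left _ _)))))))
  · exact (min_le_right _ _).trans ((min_le_right _ _).trans ((min_le_right _ _).trans ((min_le_right _ _).trans ((min_le_right _ _).trans
      ((min_le_right _ _).trans ((min_le_right _ _).trans ((min_le_right _ _).trans (min_le_left _ _))))))))
  · exact (min_le_right _ _).trans ((min_le_right _ _).trans ((min_le_right _ _).trans ((min_le_right _ _).trans ((min_le_right _ _).trans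
      ((min_le_right _ _).trans ((min_le_right _ _).trans ((min_le_right _ _).trans (min_le_right _ _))))))))

end Unpack

end Summit.HubbardSuperconductivity.HubbardSuperconductivity.Theorems.PerturbedFermiCurve

end
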